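/-
Copyright (c) 2026 the pub-hodgecm-mathlib formalisation cell (harness21).  Prover seat hodgecm-mathlib-K2E2-p12 (g10), Track B «K2-LIT», h413 = `stmt-HodgeConjecture-24833`,
route `HCCMUnconditional`; R90-TF section S8 «ContSpec-n½», deal S8-R234 (re-pointed by S8-R235 J-S8-TR; S8 dealer R90-CS-plan (g3)): THE EULER FACTORISATION OF THE SCATTERING
COORDINATES — `q_j = cS·a_j` on the tube with `a_j` holomorphic on `{1 < Re}` from the per-base-point factorisation at finitely many points of `K_max` — and its corollary, the
analyticity letter `hqa` of ★ p864687 (the scalar half of R7₃ at the candidates off `3∕2`); the amplitude rows are §3 read through `Finset.mul_sum` at the consumer (census cbce924678a394e7).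
-/
import Summits.HodgeConjecture.HodgeConjecture.Theorems.K2E1ChiMaassSelbergOnAxisScalarsOfRecordCMThree   -- ★ p864687 (this seat): `hMSP'_midWitness_of_coordLetters` (consumer of `hqa`); brings ★ spec, ★ transport, the MS road
import Summits.HodgeConjecture.HodgeConjecture.Theorems.K2E1LinearIndependentEvalMatrix                   -- ★ (K2E1-p14): `exists_points_det_ne_zero` (evaluation points with invertible matrix)
import Summits.HodgeConjecture.HodgeConjecture.Theorems.K2E1ChiIntertwiningScalarEulerQuotientU3CM        -- ★ F4 (R90-CS-p03): `exists_differentiableOn_mul_chiScalar_cm_three` (`(z−2)(2z−3)·cS = G` holomorphic on `{1<Re}`, `G 2 ≠ 0 ↔ φ = 1`)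
import Summits.HodgeConjecture.HodgeConjecture.Theorems.K2E1ChiIntertwinedCoeffKMaxCMThree                 -- ★ p864262 (K2E1-p11): `eq_zero_of_isChiSectionPair_of_forall_mem_comap` (a pair-section vanishing on `K_max` vanishes)
import Summits.HodgeConjecture.HodgeConjecture.Theorems.K2E1BLRemovablePolesU                              -- ★ `MeromorphicNFAt.analyticAt_of_eventually_norm_le` (Riemann in normal form)
import Summits.HodgeConjecture.HodgeConjecture.Theorems.K2E1ConvexDiffCountableConnected                   -- ★ `isPreconnected_convex_diff_of_countable`, `countable_of_codiscrete`
import HarnessLib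

/-!
# h413 ∕ R90-S8 — `K2E1ChiScatteringCoordsEulerFactorisationCMThree`: THE EULER FACTORISATION `q_j = cS·a_j` OF THE SCATTERING COORDINATES (`a_j` holomorphic on `{1 < Re}`) FROM THE
# PER-BASE-POINT FACTORISATION ON `K_max`, AND ITS COROLLARY — the analyticity letter `hqa` at the candidates off `3∕2` (the amplitude rows are §3 read through `Finset.mul_sum`)

Cell `pub/hodgecm-mathlib`, crux H413 = `stmt-HodgeConjecture-24833`, route `HCCMUnconditional`; R90-TF section S8, deals S8-R234 ∕ S8-R235 (J-S8-TR); rulings J-S8-U, R231 (3)(4).  THEOREMS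
ONLY (no `def`, no `instance`, no notation, no named-fact hypothesis, no `sorry`; default heartbeats); lane `--supports stmt-HodgeConjecture-24833 --as helper` (count-neutral).  Closes no socket.

THE MATHEMATICS ([MoeglinWaldspurger1995, II.1.7, IV.1.10–IV.1.11]; [Langlands1976, §6]; [ShahidiAJM1981, §2]; [BernsteinLapid2019, §4 p. 10, §7]).  On the tube `{2 < Re}` the intertwined
coefficient `φ̃_z = (ν𝓕)·Σ_j q_j(z)·φ′_j` (★ spec clause 2; columns `φ′_j = bV j` of `V(χʷ, K′, ω)`) is determined by its values at FINITELY MANY base points `g_k ∈ K_max` with invertible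
evaluation matrix `M_{jk} = φ′_j(g_k)` (★ p14 `exists_points_det_ne_zero` — the columns are linearly independent AS FUNCTIONS ON `K_max`, §2, because a pair-section vanishing on `K_max`
vanishes ★): `q(z) = (Mᵀ)⁻¹·(φ̃_z(g_k))_k` (Cramer).  So the EULER FACTORISATION of the intertwining operator on the block [MW95 II.1.7; Langlands §6; Shahidi §2] is needed only AT THOSE
POINTS: «`φ̃_z(g_k) = cS(z)·A_k(z)` with `A_k` holomorphic on `{1 < Re}`» (the letter `hunfK`: ★ p864589's unfolding head at the base point `g_k` ∘ the pure-tensor reading of the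
`K_max`-translate ∘ holomorphy of the local amplitudes) gives `q_j = cS·a_j`, `a_j := Σ_k (Mᵀ)⁻¹_{jk} A_k` HOLOMORPHIC ON `{1 < Re}` (§1, generic).  COROLLARY `hqa` (§4): the continued
coordinate `qc_j` (NORMAL FORM on `ℂ`, analytic off the closed co-discrete `P ⊆ {Re ≤ 2}`, `= q_j` on the tube — clauses 4, 11, 9, 6) satisfies `(z−2)(2z−3)·qc_j = G·a_j` on the CONNECTED
`{1 < Re} ∖ P` (★ F4: `(z−2)(2z−3)·cS = G` holomorphic on `{1<Re}`, `G(2) = 0` for `φ ≠ 1`; identity theorem), hence is BOUNDED near every candidate `z₀ ∈ P`, `1 < Re z₀`, `z₀ ≠ 3∕2`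
(at `z₀ = 2`: `‖G·a_j‖ = O(‖z − 2‖)`), hence ANALYTIC there (Riemann in normal form ★) — the letter `hqa` of ★ p864687 `hMSP'_midWitness_of_coordLetters`, byte for byte.
* §1 **`exists_factorisation_of_coords_at_points`** (generic: `X`, `ι` finite, invertible evaluation matrix, `Σ_j q_j(z)•φ′_j = Φ z` on `S`, `Φ z (g k) = cS z·A_k z` on `S`, `A_k`
  holomorphic on `U` ⊢ `a_j` holomorphic on `U`, `q_j = cS·a_j` on `S`, with the Cramer formula).
* §2 **`linearIndependent_restrict_comap_of_isChiSectionPair`** — pair-section columns stay linearly independent on `K_max`.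
* §3 **`exists_eulerFactorisation_midWitness`** — OF RECORD: from `hunfK` on `K_max`, `∃ a, (∀ j, DifferentiableOn ℂ (a j) {1<Re}) ∧ ∀ j z, 2 < Re z → midWitnessQ j z = cS z * a j z`,
  (the amplitude rows «`(ν𝓕)Σ_j q_j φ′_j = cS·[(ν𝓕)Σ_j a_j φ′_j]` on the tube, the bracket holomorphic on `{1<Re}` pointwise in `g`» are this ∘ `Finset.mul_sum` at the consumer).
* §4 `eventually_norm_le_of_eqOn_mul` (the bound near a candidate, incl. `z₀ = 2`), HEAD **`hqa_of_eulerFactorisation`** ⊢ ★ p864687's `hqa` binder; **`hMSP'_midWitness_of_unfolding`** (one call).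
HONEST LABEL: HC_CM is proved only modulo the 7 printed citations (2 remaining named inputs: hLiu418 = `stmt-HodgeConjecture-24832`, h413 = `stmt-HodgeConjecture-24833`) until rung 0
closes; this file asserts no named fact and closes no socket; `hqa` and the amplitude rows become ★ MODULO the ONE named letter `hunfK` (the (W)-core's output at the base points of `K_max`),
`φ ≠ 1` and F4's frame; `hreal` untouched; count-neutral.

## References
* [MoeglinWaldspurger1995] C. Mœglin, J.-L. Waldspurger, *Spectral Decomposition and Eisenstein Series* (1995), II.1.7, IV.1.10–IV.1.11.
* [Langlands1976] R. P. Langlands, *On the Functional Equations Satisfied by Eisenstein Series*, LNM 544 (1976), §6.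
* [ShahidiAJM1981] F. Shahidi, *On certain L-functions*, Amer. J. Math. 103 (1981), §2.
* [BernsteinLapid2019] J. Bernstein, E. Lapid, *On the meromorphic continuation of Eisenstein series*, J. AMS 37 (2024), §4 p. 10, §7.
-/

set_option autoImplicit false
set_option linter.dupNamespace false  -- the mandated namespace repeats the summit's segment (`HodgeConjecture.HodgeConjecture`)

noncomputable section

open MeasureTheory Measure NumberField IsDedekindDomain Set Filter Topology Matrix
open scoped ENNReal NNReal Asymptotics ComplexConjugate
open Literature.MeasureTheory.Group Literature.NumberTheory Literature.NumberTheory.Automorphic Literature.NumberTheory.Automorphic.UnitaryGroup Literature.NumberTheory.GaloisRepresentations AdelicGroupData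
open Literature.NumberTheory.Automorphic.Arthur2013.Leaves.TECR Literature.NumberTheory.Rogawski1990 Literature.NumberTheory.LFunctions
open Summit.HodgeConjecture.HodgeConjecture.Cruxes.H413.K2E1BorelEisensteinU Summit.HodgeConjecture.HodgeConjecture.Cruxes.H413.K2E1CharacterEisensteinU2Defs
open Summit.HodgeConjecture.HodgeConjecture.Cruxes.H413.K2E1CharacterEisensteinU3PairDefs Summit.HodgeConjecture.HodgeConjecture.Cruxes.H413.K2E1BLBorelSpacesU2Defs
open Summit.HodgeConjecture.HodgeConjecture.Cruxes.H413.K2E1ChiSectionSpaceU2Defs (chiSectionSpace isChiSection_of_mem)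
open Summit.HodgeConjecture.HodgeConjecture.Cruxes.H413.K2E1ChiEisensteinMeromorphicExportsM1CMThree (one_apply_torus isAutomorphic_one)
open Summit.HodgeConjecture.HodgeConjecture.Cruxes.H413.K2E1LinearIndependentEvalMatrix (exists_points_det_ne_zero)
open Summit.HodgeConjecture.HodgeConjecture.Cruxes.H413.K2E1ChiIntertwiningScalarEulerQuotientU3CM (exists_differentiableOn_mul_chiScalar_cm_three)
open Summit.HodgeConjecture.HodgeConjecture.Cruxes.H413.K2E1ChiIntertwinedCoeffKMaxCMThree (eq_zero_of_isChiSectionPair_of_forall_mem_comap)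
open Summit.HodgeConjecture.HodgeConjecture.Cruxes.H413.K2E1ConvexDiffCountableConnected (isPreconnected_convex_diff_of_countable countable_of_codiscrete)
open Summit.HodgeConjecture.HodgeConjecture.Cruxes.H413.K2E1ChiMaassSelbergOnAxisScalarsOfRecordCMThree (hMSP'_midWitness_of_coordLetters)
open Summit.HodgeConjecture.HodgeConjecture.R90.S8 (midWitnessEc midWitnessP midWitnessQc midWitnessQ midWitnessExports_spec)

namespace Summit.HodgeConjecture.HodgeConjecture.Cruxes.H413.K2E1ChiScatteringCoordsEulerFactorisationCMThree

/-! ## §1 The generic engine: coordinates factorise when the family does at the evaluation points -/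

section Engine

/-- **COORDINATES FACTORISE WHEN THE FAMILY DOES AT THE EVALUATION POINTS** (Cramer): `φ′_j : X → ℂ` with an invertible evaluation matrix at `g : ι → X`; coordinates `q_j` with
`Σ_j q_j(z)•φ′_j = Φ z` on `S`; `Φ z (g k) = cS z·A_k z` on `S` with `A_k` holomorphic on `U`.  THEN `a_j := Σ_k (Mᵀ)⁻¹_{jk}·A_k` is holomorphic on `U` and `q_j = cS·a_j` on `S`.
[cite: BernsteinLapid2019, §4 p. 10, §7] -/
theorem exists_factorisation_of_coords_at_points {X ι : Type*} [Fintype ι] [DecidableEq ι] {φ' : ι → X → ℂ} {g : ι → X}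
    (hdet : (Matrix.of fun j k : ι => φ' j (g k)).det ≠ 0)
    {S U : Set ℂ} {q : ι → ℂ → ℂ} {Φ : ℂ → X → ℂ} (hq : ∀ z ∈ S, (∑ j, q j z • φ' j) = Φ z)
    {cS : ℂ → ℂ} {A : ι → ℂ → ℂ} (hΦ : ∀ z ∈ S, ∀ k, Φ z (g k) = cS z * A k z) (hA : ∀ k, DifferentiableOn ℂ (A k) U) :
    ∃ a : ι → ℂ → ℂ, (∀ j, DifferentiableOn ℂ (a j) U) ∧ (∀ j, ∀ z ∈ S, q j z = cS z * a j z) ∧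
      ∀ j z, a j z = ∑ k, ((Matrix.of fun j k : ι => φ' j (g k))ᵀ)⁻¹ j k * A k z := by
  set M : Matrix ι ι ℂ := Matrix.of fun j k : ι => φ' j (g k) with hM
  have hdetT : IsUnit Mᵀ.det := isUnit_iff_ne_zero.2 (by rwa [Matrix.det_transpose])
  refine ⟨fun j z => ∑ k, Mᵀ⁻¹ j k * A k z, fun j => DifferentiableOn.fun_sum fun k _ => (hA k).const_mul _, fun j z hz => ?_, fun j z => rfl⟩
  -- on `S`: `Mᵀ (q · z) = (Φ z (g k))_k = cS z • (A · z)`, so `q · z = Mᵀ⁻¹ (cS z • A · z)`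
  have hval : (Mᵀ *ᵥ fun j => q j z) = fun k => cS z * A k z := by
    funext k
    have h := congrFun (hq z hz) (g k)
    rw [Finset.sum_apply] at h
    simp only [Pi.smul_apply, smul_eq_mul] at h
    rw [hΦ z hz k] at h
    rw [← h]
    simp only [Matrix.mulVec, dotProduct, Matrix.transpose_apply, hM, Matrix.of_apply]
    exact Finset.sum_congr rfl fun j _ => mul_comm _ _
  have hsolve : (fun j => q j z) = Mᵀ⁻¹ *ᵥ fun k => cS z * A k z := by
    rw [← hval, Matrix.mulVec_mulVec, Matrix.nonsing_inv_mul _ hdetT, Matrix.one_mulVec]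
  have hj := congrFun hsolve j
  simp only [Matrix.mulVec, dotProduct] at hj
  rw [hj, Finset.mul_sum]
  exact Finset.sum_congr rfl fun k _ => by ring

end Engine

/-! ## §2 The columns stay linearly independent on `K_max` -/

section Columns

variable (L : Type) [Field L] [NumberField L] [IsCMField L]

/-- **PAIR-SECTION COLUMNS ARE LINEARLY INDEPENDENT AS FUNCTIONS ON `K_max`**: if `b_j : G(𝔸) → ℂ` are linearly independent `(χ₁, χ₂)`-pair-sections, so are their restrictions to
`K_max = val⁻¹(K_∞·GL₃(𝒪̂))` — a vanishing linear combination on `K_max` is a pair-section vanishing on `K_max`, hence zero (★ `eq_zero_of_isChiSectionPair_of_forall_mem_comap`, adelic Iwasawa).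
[cite: MoeglinWaldspurger1995, I.2.17, II.1.7] -/
theorem linearIndependent_restrict_comap_of_isChiSectionPair {ι : Type*} {χ₁ : HeckeCharacter L} {χ₂ : ↥(TorusDict.torus (IsCMField.complexConj L)) →ₜ* ℂˣ}
    {b : ι → (quasiSplit (↥(maximalRealSubfield L)) L (IsCMField.complexConj L) 3).Adelic → ℂ} (hli : LinearIndependent ℂ b) (hb : ∀ j, IsChiSectionPair χ₁ χ₂ (b j)) :
    LinearIndependent ℂ (fun j (k : ↥((standardMaximalCompactGL 3 L).comap (adelicVal (↥(maximalRealSubfield L)) L (IsCMField.complexConj L) 3 ((StdForm.antidiagonal 3).over L)) : Subgroup (quasiSplit (↥(maximalRealSubfield L)) L (IsCMField.complexConj L) 3).Adelic)) => b j (k : (quasiSplit (↥(maximalRealSubfield L)) L (IsCMField.complexConj L) 3).Adelic)) := by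
  classical
  refine linearIndependent_iff'.2 fun s c hc j hj => ?_
  -- the combination `Σ_{i∈s} c_i • b_i` is a pair-section vanishing on `K_max`, hence `0`
  have hsec : ∀ t : Finset ι, IsChiSectionPair χ₁ χ₂ (∑ i ∈ t, c i • b i) := fun t => by
    induction t using Finset.induction_on with
    | empty => simpa using IsChiSectionPair.zero χ₁ χ₂
    | insert a t hat ih => rw [Finset.sum_insert hat]; exact ((hb a).smul (c a)).add ih
  have hK : ∀ k ∈ ((standardMaximalCompactGL 3 L).comap (adelicVal (↥(maximalRealSubfield L)) L (IsCMField.complexConj L) 3 ((StdForm.antidiagonal 3).over L)) : Subgroup (quasiSplit (↥(maximalRealSubfield L)) L (IsCMField.complexConj L) 3).Adelic), (∑ i ∈ s, c i • b i) k = 0 := fun k hk => by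
    have h := congrFun hc ⟨k, hk⟩
    simpa only [Finset.sum_apply, Pi.smul_apply, smul_eq_mul, Pi.zero_apply] using h
  have h0 := eq_zero_of_isChiSectionPair_of_forall_mem_comap L (hsec s) hK
  exact linearIndependent_iff'.1 hli s c h0 j hj

end Columns

/-! ## §3 OF RECORD: the Euler factorisation of the named tube coordinates from the per-base-point factorisation on `K_max` -/

section OfRecord
variable (L : Type) [Field L] [NumberField L] [IsCMField L] [MeasurableSpace (quasiSplit (↥(maximalRealSubfield L)) L (IsCMField.complexConj L) 3).Adelic] [BorelSpace (quasiSplit (↥(maximalRealSubfield L)) L (IsCMField.complexConj L) 3).Adelic]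
  [MeasurableSpace (arch (↥(maximalRealSubfield L)) L (IsCMField.complexConj L) 3 ((StdForm.antidiagonal 3).over L))] [BorelSpace (arch (↥(maximalRealSubfield L)) L (IsCMField.complexConj L) 3 ((StdForm.antidiagonal 3).over L))]
  [MeasurableSpace (finAdelic (↥(maximalRealSubfield L)) L (IsCMField.complexConj L) 3 ((StdForm.antidiagonal 3).over L))] [BorelSpace (finAdelic (↥(maximalRealSubfield L)) L (IsCMField.complexConj L) 3 ((StdForm.antidiagonal 3).over L))]

/-- **THE EULER FACTORISATION OF THE SCATTERING COORDINATES OF RECORD**: if at every base point `k ∈ K_max` the intertwining integral of the M1 section factorises on the tube as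
`∫_N φ_z(w₀·v·k) dν = cS(z)·A_k(z)` with `A_k` holomorphic on `{1 < Re}` (the letter `hunfK`: ★ p864589's unfolding at `k` ∘ the pure-tensor reading of the `K_max`-translate ∘ holomorphy of
the local amplitudes), then the tube coordinates of record (★ `midWitnessQ`, spec clause 2 with `ν 𝓕 = 1`) factorise as `midWitnessQ j z = cS z·a j z` on `{2 < Re}` with every `a j`
HOLOMORPHIC ON `{1 < Re}` (§1 at evaluation points in `K_max`, §2 for their existence). [cite: MoeglinWaldspurger1995, II.1.7, IV.1.11] [cite: Langlands1976, §6] [cite: BernsteinLapid2019, §7] -/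
theorem exists_eulerFactorisation_midWitness
    (μ : Measure (quasiSplit (↥(maximalRealSubfield L)) L (IsCMField.complexConj L) 3).automorphicQuotient) [(quasiSplit (↥(maximalRealSubfield L)) L (IsCMField.complexConj L) 3).IsAutomorphicMeasure μ]
    (νG : Measure (quasiSplit (↥(maximalRealSubfield L)) L (IsCMField.complexConj L) 3).Adelic) [νG.IsHaarMeasure] [νG.IsInvInvariant] [SFinite νG]
    (ν : Measure ↥(adelicUnipotent (↥(maximalRealSubfield L)) L (IsCMField.complexConj L) 3)) [ν.IsHaarMeasure] [ν.IsMulRightInvariant] [ν.IsInvInvariant]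
    {𝓕 : Set ↥(adelicUnipotent (↥(maximalRealSubfield L)) L (IsCMField.complexConj L) 3)}
    (h𝓕N : IsFundamentalDomain ↥(rationalUnipotent (↥(maximalRealSubfield L)) L (IsCMField.complexConj L) 3) 𝓕 ν) (h𝓕c : IsCompact (closure 𝓕)) (h𝓕₀ : ν 𝓕 ≠ 0)
    {β : (quasiSplit (↥(maximalRealSubfield L)) L (IsCMField.complexConj L) 3).Adelic → ℝ≥0∞}
    (hβ : IsCoveringWeight ↥((arithmeticBorel (↥(maximalRealSubfield L)) L (IsCMField.complexConj L) 3).map (quasiSplit (↥(maximalRealSubfield L)) L (IsCMField.complexConj L) 3).arithmeticSubgroup.subtype) β)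
    {μZ : Measure (borelQuotient (↥(maximalRealSubfield L)) L (IsCMField.complexConj L) 3)} [SFinite μZ]
    (hμZ : ∀ f : borelQuotient (↥(maximalRealSubfield L)) L (IsCMField.complexConj L) 3 → ℝ≥0∞, Measurable f → ∫⁻ z, f z ∂μZ = ∫⁻ g, β g * f (toBorelQuotient (↥(maximalRealSubfield L)) L (IsCMField.complexConj L) 3 g) ∂νG)
    -- the M1 family: `φ ∈ V(χ, K, 1)` continuous bounded with `φ ∘ ι_∞ = φ(1)`, and a basis of `V(χʷ, K, 1)` by continuous bounded functions
    {χ : HeckeCharacter L} {K' : Subgroup (quasiSplit (↥(maximalRealSubfield L)) L (IsCMField.complexConj L) 3).Adelic} {ω : ↥K' → ℂ} {φ : (quasiSplit (↥(maximalRealSubfield L)) L (IsCMField.complexConj L) 3).Adelic → ℂ} (hφV : φ ∈ chiSectionSpace χ K' ω) (hφc : Continuous φ) {Mφ : ℝ} (hφM : ∀ x, ‖φ x‖ ≤ Mφ)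
    -- the LEVEL: `K′ ≤ K`, `ι(K_∞) ⊆ K′`, an open compact `U₀` with `ι_f(U₀ ∩ G_f) ⊆ K′` on which `ω = 1`, continuity of the sections; auxiliary Haar measures on `G_∞` (two-sided) and `G(𝔸_f)`
    (hK' : K' ≤ ((standardMaximalCompactGL 3 L).comap (adelicVal (↥(maximalRealSubfield L)) L (IsCMField.complexConj L) 3 ((StdForm.antidiagonal 3).over L)) : Subgroup (quasiSplit (↥(maximalRealSubfield L)) L (IsCMField.complexConj L) 3).Adelic))
    (hKinf : ∀ k : arch (↥(maximalRealSubfield L)) L (IsCMField.complexConj L) 3 ((StdForm.antidiagonal 3).over L), adelicVal (↥(maximalRealSubfield L)) L (IsCMField.complexConj L) 3 ((StdForm.antidiagonal 3).over L) (archToAdelic (↥(maximalRealSubfield L)) L (IsCMField.complexConj L) 3 _ k) ∈ standardMaximalCompactGL 3 L →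
      archToAdelic (↥(maximalRealSubfield L)) L (IsCMField.complexConj L) 3 _ k ∈ K')
    (U₀ : Subgroup (GL (Fin 3) (FiniteAdeleRing (𝓞 L) L))) (hU₀o : IsOpen (U₀ : Set (GL (Fin 3) (FiniteAdeleRing (𝓞 L) L)))) (hU₀c : IsCompact (U₀ : Set (GL (Fin 3) (FiniteAdeleRing (𝓞 L) L))))
    (hU : ∀ b : finAdelic (↥(maximalRealSubfield L)) L (IsCMField.complexConj L) 3 ((StdForm.antidiagonal 3).over L), (b : GL (Fin 3) (FiniteAdeleRing (𝓞 L) L)) ∈ U₀ →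
      ∃ hb : finAdelicToAdelic (↥(maximalRealSubfield L)) L (IsCMField.complexConj L) 3 ((StdForm.antidiagonal 3).over L) b ∈ K', ω ⟨_, hb⟩ = 1)
    (hVc : ∀ φ ∈ chiSectionSpace χ K' ω, Continuous φ)
    (μa : Measure (arch (↥(maximalRealSubfield L)) L (IsCMField.complexConj L) 3 ((StdForm.antidiagonal 3).over L))) [μa.IsHaarMeasure] [μa.IsMulRightInvariant]
    (μf : Measure (finAdelic (↥(maximalRealSubfield L)) L (IsCMField.complexConj L) 3 ((StdForm.antidiagonal 3).over L))) [μf.IsHaarMeasure]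
    {ι' : Type} [Fintype ι'] [DecidableEq ι'] (bV : Module.Basis ι' ℂ ↥(chiSectionSpace (reflectChar (IsCMField.complexConj L) χ) K' ω))
    (hbc : ∀ j, Continuous ((bV j : ↥(chiSectionSpace (reflectChar (IsCMField.complexConj L) χ) K' ω)) : (quasiSplit (↥(maximalRealSubfield L)) L (IsCMField.complexConj L) 3).Adelic → ℂ)) {Mb : ℝ} (hbM : ∀ j x, ‖((bV j : ↥(chiSectionSpace (reflectChar (IsCMField.complexConj L) χ) K' ω)) : (quasiSplit (↥(maximalRealSubfield L)) L (IsCMField.complexConj L) 3).Adelic → ℂ) x‖ ≤ Mb)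
    (h2 : Module.finrank (↥(maximalRealSubfield L)) L = 2) (hc : IsCMField.complexConj L ≠ 1) (hJ : ((StdForm.antidiagonal 3).over L).det ≠ 0)
    (ψ : ↥(TorusDict.torus (IsCMField.complexConj L)) →ₜ* ℂˣ) (hψ : TorusDict.IsAutomorphic (IsCMField.complexConj L) ψ)
    (h𝓕1 : ν 𝓕 = 1) {cS : ℂ → ℂ}
    (hunfK : ∀ k : (quasiSplit (↥(maximalRealSubfield L)) L (IsCMField.complexConj L) 3).Adelic, adelicVal (↥(maximalRealSubfield L)) L (IsCMField.complexConj L) 3 ((StdForm.antidiagonal 3).over L) k ∈ standardMaximalCompactGL 3 L →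
      ∃ A : ℂ → ℂ, DifferentiableOn ℂ A {z : ℂ | 1 < z.re} ∧ ∀ z : ℂ, 2 < z.re →
        (∫ v : ↥(adelicUnipotent (↥(maximalRealSubfield L)) L (IsCMField.complexConj L) 3), flatSectionU φ z ((quasiSplit (↥(maximalRealSubfield L)) L (IsCMField.complexConj L) 3).toAdelic (weylLongU ((IsCMField.complexConj L : L ≃ₐ[↥(maximalRealSubfield L)] L) : L →+* L) (rfl : (StdForm.antidiagonal 3).over L = (StdForm.antidiagonal 3).over L)) * ((v : (quasiSplit (↥(maximalRealSubfield L)) L (IsCMField.complexConj L) 3).Adelic) * k)) ∂ν) = cS z * A z) :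
    ∃ a : ι' → ℂ → ℂ, (∀ j, DifferentiableOn ℂ (a j) {z : ℂ | 1 < z.re}) ∧
      ∀ j (z : ℂ), 2 < z.re → midWitnessQ L μ νG ν h𝓕N h𝓕c h𝓕₀ hβ hμZ hφV hφc hφM hK' hKinf U₀ hU₀o hU₀c hU hVc μa μf bV hbc hbM h2 hc hJ ψ hψ j z = cS z * a j z := by
  classical
  obtain ⟨-, hqφ, -⟩ := midWitnessExports_spec L μ νG ν h𝓕N h𝓕c h𝓕₀ hβ hμZ hφV hφc hφM hK' hKinf U₀ hU₀o hU₀c hU hVc μa μf bV hbc hbM h2 hc hJ ψ hψ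
  -- the columns as `(χʷ, 1)`-pair-sections, linearly independent on `K_max` (§2); evaluation points there (★ p14)
  have hb : ∀ j, IsChiSectionPair (reflectChar (IsCMField.complexConj L) χ) (1 : ↥(TorusDict.torus (IsCMField.complexConj L)) →ₜ* ℂˣ) ((bV j : ↥(chiSectionSpace (reflectChar (IsCMField.complexConj L) χ) K' ω)) : (quasiSplit (↥(maximalRealSubfield L)) L (IsCMField.complexConj L) 3).Adelic → ℂ) := fun j =>
    IsChiSection.isChiSectionPair_of_trivial (one_apply_torus (IsCMField.complexConj L)) (bV j).2.1
  have hli : LinearIndependent ℂ (fun j => ((bV j : ↥(chiSectionSpace (reflectChar (IsCMField.complexConj L) χ) K' ω)) : (quasiSplit (↥(maximalRealSubfield L)) L (IsCMField.complexConj L) 3).Adelic → ℂ)) := bV.linearIndependent.map' (Submodule.subtype _) (Submodule.ker_subtype _)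
  obtain ⟨gK, hdet⟩ := exists_points_det_ne_zero (linearIndependent_restrict_comap_of_isChiSectionPair L hli hb)
  -- the letter at the evaluation points
  choose A hA hfac using fun k : ι' => hunfK (gK k : (quasiSplit (↥(maximalRealSubfield L)) L (IsCMField.complexConj L) 3).Adelic) (Subgroup.mem_comap.1 (gK k).2)
  -- the tube identity at the points of `K_max` (`ν 𝓕 = 1`, `H(k) = 1`)
  have hq : ∀ z ∈ {z : ℂ | 2 < z.re}, (∑ j, midWitnessQ L μ νG ν h𝓕N h𝓕c h𝓕₀ hβ hμZ hφV hφc hφM hK' hKinf U₀ hU₀o hU₀c hU hVc μa μf bV hbc hbM h2 hc hJ ψ hψ j z • fun k : ↥((standardMaximalCompactGL 3 L).comap (adelicVal (↥(maximalRealSubfield L)) L (IsCMField.complexConj L) 3 ((StdForm.antidiagonal 3).over L)) : Subgroup (quasiSplit (↥(maximalRealSubfield L)) L (IsCMField.complexConj L) 3).Adelic) => ((bV j : ↥(chiSectionSpace (reflectChar (IsCMField.complexConj L) χ) K' ω)) : (quasiSplit (↥(maximalRealSubfield L)) L (IsCMField.complexConj L) 3).Adelic → ℂ) (k : (quasiSplit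 (↥(maximalRealSubfield L)) L (IsCMField.complexConj L) 3).Adelic)) =
      fun k : ↥((standardMaximalCompactGL 3 L).comap (adelicVal (↥(maximalRealSubfield L)) L (IsCMField.complexConj L) 3 ((StdForm.antidiagonal 3).over L)) : Subgroup (quasiSplit (↥(maximalRealSubfield L)) L (IsCMField.complexConj L) 3).Adelic) => (∫ v : ↥(adelicUnipotent (↥(maximalRealSubfield L)) L (IsCMField.complexConj L) 3), flatSectionU φ z ((quasiSplit (↥(maximalRealSubfield L)) L (IsCMField.complexConj L) 3).toAdelic (weylLongU ((IsCMField.complexConj L : L ≃ₐ[↥(maximalRealSubfield L)] L) : L →+* L) (rfl : (StdForm.antidiagonal 3).over L = (StdForm.antidiagonal 3).over L)) * ((v : (quasiSplit (↥(maximalRealSubfield L)) L (IsCMField.complexConj L) 3).Adelic) * (k : (quasiSplit (↥(maximalRealSubfield L)) L (IsCMField.complexConj L) 3).Adelic))) ∂ν) := by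
    intro z hz
    funext k
    have h := congrFun (hqφ z hz) (k : (quasiSplit (↥(maximalRealSubfield L)) L (IsCMField.complexConj L) 3).Adelic)
    rw [h𝓕1, ENNReal.toReal_one, inv_one, Complex.ofReal_one, one_smul] at h
    rw [Finset.sum_apply] at h ⊢
    simp only [Pi.smul_apply, smul_eq_mul] at h ⊢
    rw [h, Summit.HodgeConjecture.HodgeConjecture.Cruxes.H413.K2E1SphericalHeckeEigenSectionU2.borelHeight_eq_one_of_mem (Subgroup.mem_comap.1 k.2), NNReal.coe_one,
      Complex.ofReal_one, Complex.one_cpow, mul_one]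
  obtain ⟨a, ha, hqa', -⟩ := exists_factorisation_of_coords_at_points (X := ↥((standardMaximalCompactGL 3 L).comap (adelicVal (↥(maximalRealSubfield L)) L (IsCMField.complexConj L) 3 ((StdForm.antidiagonal 3).over L)) : Subgroup (quasiSplit (↥(maximalRealSubfield L)) L (IsCMField.complexConj L) 3).Adelic))
    (φ' := fun j (k : ↥((standardMaximalCompactGL 3 L).comap (adelicVal (↥(maximalRealSubfield L)) L (IsCMField.complexConj L) 3 ((StdForm.antidiagonal 3).over L)) : Subgroup (quasiSplit (↥(maximalRealSubfield L)) L (IsCMField.complexConj L) 3).Adelic)) => ((bV j : ↥(chiSectionSpace (reflectChar (IsCMField.complexConj L) χ) K' ω)) : (quasiSplit (↥(maximalRealSubfield L)) L (IsCMField.complexConj L) 3).Adelic → ℂ) (k : (quasiSplit (↥(maximalRealSubfield L)) L (IsCMField.complexConj L) 3).Adelic)) (g := gK)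
    (Φ := fun (z : ℂ) (k : ↥((standardMaximalCompactGL 3 L).comap (adelicVal (↥(maximalRealSubfield L)) L (IsCMField.complexConj L) 3 ((StdForm.antidiagonal 3).over L)) : Subgroup (quasiSplit (↥(maximalRealSubfield L)) L (IsCMField.complexConj L) 3).Adelic)) => (∫ v : ↥(adelicUnipotent (↥(maximalRealSubfield L)) L (IsCMField.complexConj L) 3), flatSectionU φ z ((quasiSplit (↥(maximalRealSubfield L)) L (IsCMField.complexConj L) 3).toAdelic (weylLongU ((IsCMField.complexConj L : L ≃ₐ[↥(maximalRealSubfield L)] L) : L →+* L) (rfl : (StdForm.antidiagonal 3).over L = (StdForm.antidiagonal 3).over L)) * ((v : (quasiSplit (↥(maximalRealSubfield L)) L (IsCMField.complexConj L) 3).Adelic) * (k : (quasiSplit (↥(maximalRealSubfield L)) L (IsCMField.complexConj L) 3).Adelic))) ∂ν))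
    (cS := cS) (A := A) hdet hq (fun z hz k => hfac k z hz) hA
  exact ⟨a, ha, fun j z hz => hqa' j z hz⟩

end OfRecord

/-! ## §4 The analyticity letter `hqa` at the candidates off `3∕2`, and `hMSP′` in one call -/

section Bound

/-- **THE BOUND NEAR A CANDIDATE FROM THE FACTORED IDENTITY**: if `(z − 2)(2z − 3)·qc z = H z` on a set `D` that contains a punctured neighbourhood of `z₀ ≠ 3∕2`, with `H` differentiable
at `z₀` and `H 2 = 0` in case `z₀ = 2`, then `qc` is bounded on a punctured neighbourhood of `z₀`. [cite: MoeglinWaldspurger1995, IV.1.11] -/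
theorem eventually_norm_le_of_eqOn_mul {qc H : ℂ → ℂ} {D : Set ℂ} {z₀ : ℂ} (hD : ∀ᶠ z in 𝓝[≠] z₀, z ∈ D)
    (hEq : EqOn (fun z => (z - 2) * (2 * z - 3) * qc z) H D) (hH : DifferentiableAt ℂ H z₀) (h32 : z₀ ≠ 3 / 2) (h2 : z₀ = 2 → H 2 = 0) :
    ∃ C : ℝ, ∀ᶠ z in 𝓝[≠] z₀, ‖qc z‖ ≤ C := by
  -- the identity in norm form on `D`
  have hnorm : ∀ z ∈ D, ‖z - 2‖ * ‖2 * z - 3‖ * ‖qc z‖ = ‖H z‖ := fun z hz => by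
    rw [← norm_mul, ← norm_mul]; exact congrArg norm (hEq hz)
  by_cases h2' : z₀ = 2
  · -- at `z₀ = 2`: `‖H z‖ ≤ C‖z − 2‖` near `2` and `‖2z − 3‖ ≥ 1∕2`
    subst h2'
    have hH0 : H 2 = 0 := h2 rfl
    obtain ⟨C, hC⟩ := hH.isBigO_sub.bound
    have h23 : ∀ᶠ z in 𝓝 (2 : ℂ), (1 / 2 : ℝ) < ‖2 * z - 3‖ :=
      ((continuous_const.mul continuous_id).sub continuous_const).continuousAt.norm.eventually (Ioi_mem_nhds (by norm_num))
    refine ⟨2 * max C 0, ?_⟩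
    filter_upwards [hD, mem_nhdsWithin_of_mem_nhds hC, mem_nhdsWithin_of_mem_nhds h23, self_mem_nhdsWithin] with z hzD hCz h23z hz2
    rw [hH0, sub_zero] at hCz
    have hz2' : 0 < ‖z - 2‖ := norm_pos_iff.2 (sub_ne_zero.2 hz2)
    have h1 : ‖z - 2‖ * (‖2 * z - 3‖ * ‖qc z‖) ≤ ‖z - 2‖ * max C 0 := by
      rw [← mul_assoc, hnorm z hzD, mul_comm]
      exact hCz.trans (mul_le_mul_of_nonneg_right (le_max_left _ _) (norm_nonneg _))
    have h2'' : ‖2 * z - 3‖ * ‖qc z‖ ≤ max C 0 := le_of_mul_le_mul_left h1 hz2'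
    have h3 : (1 / 2 : ℝ) * ‖qc z‖ ≤ max C 0 := (mul_le_mul_of_nonneg_right h23z.le (norm_nonneg _)).trans h2''
    linarith
  · -- off `2`: `(z − 2)(2z − 3)` stays away from `0` near `z₀`
    have hp0 : (z₀ - 2) * (2 * z₀ - 3) ≠ 0 := by
      refine mul_ne_zero (sub_ne_zero.2 h2') fun h => h32 ?_
      linear_combination h / 2
    have hpos : 0 < ‖(z₀ - 2) * (2 * z₀ - 3)‖ / 2 := half_pos (norm_pos_iff.2 hp0)
    have hp : ∀ᶠ z in 𝓝 z₀, ‖(z₀ - 2) * (2 * z₀ - 3)‖ / 2 < ‖(z - 2) * (2 * z - 3)‖ :=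
      (((continuous_id.sub continuous_const).mul ((continuous_const.mul continuous_id).sub continuous_const)).continuousAt.norm.eventually
        (Ioi_mem_nhds (half_lt_self (norm_pos_iff.2 hp0))))
    have hHb : ∀ᶠ z in 𝓝 z₀, ‖H z‖ < ‖H z₀‖ + 1 := hH.continuousAt.norm.eventually (gt_mem_nhds (lt_add_one _))
    refine ⟨(‖H z₀‖ + 1) / (‖(z₀ - 2) * (2 * z₀ - 3)‖ / 2), ?_⟩
    filter_upwards [hD, mem_nhdsWithin_of_mem_nhds hp, mem_nhdsWithin_of_mem_nhds hHb] with z hzD hpz hHz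
    have hpz0 : 0 < ‖(z - 2) * (2 * z - 3)‖ := hpos.trans hpz
    have e : ‖qc z‖ = ‖H z‖ / ‖(z - 2) * (2 * z - 3)‖ := by
      rw [eq_div_iff hpz0.ne', mul_comm, norm_mul, hnorm z hzD]
    rw [e]
    exact div_le_div₀ (by positivity) hHz.le hpos hpz.le

end Bound

section Hqa
variable (L : Type) [Field L] [NumberField L] [IsCMField L] [MeasurableSpace (quasiSplit (↥(maximalRealSubfield L)) L (IsCMField.complexConj L) 3).Adelic] [BorelSpace (quasiSplit (↥(maximalRealSubfield L)) L (IsCMField.complexConj L) 3).Adelic]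
  [MeasurableSpace (arch (↥(maximalRealSubfield L)) L (IsCMField.complexConj L) 3 ((StdForm.antidiagonal 3).over L))] [BorelSpace (arch (↥(maximalRealSubfield L)) L (IsCMField.complexConj L) 3 ((StdForm.antidiagonal 3).over L))]
  [MeasurableSpace (finAdelic (↥(maximalRealSubfield L)) L (IsCMField.complexConj L) 3 ((StdForm.antidiagonal 3).over L))] [BorelSpace (finAdelic (↥(maximalRealSubfield L)) L (IsCMField.complexConj L) 3 ((StdForm.antidiagonal 3).over L))]

/-- **`hqa` FROM THE EULER FACTORISATION — THE SCALAR HALF OF R7₃ AT THE CANDIDATES OFF `3∕2`**: with `hunfK` for the partial `L`-ratio `cS(z) = L^S(φ,z−1)L^T(η,2z−2)∕(L^S(φ,z)L^T(η,2z−1))`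
of ★ F4's frame (`φ, η` unitary, trivial on the positive reals, unramified off the finite `S, T`; `φ ≠ 1`), every continued coordinate `midWitnessQc j` is ANALYTIC at every candidate
`z₀ ∈ midWitnessP` with `1 < Re z₀`, `z₀ ≠ 3∕2` — the letter `hqa` of ★ p864687 `hMSP'_midWitness_of_coordLetters` BYTE FOR BYTE: `(z−2)(2z−3)·qc_j = G·a_j` on the connected
`{1<Re} ∖ P` (§3 + ★ F4 + identity theorem), boundedness near `z₀` (§4 `eventually_norm_le_of_eqOn_mul`, `G 2 = 0` as `φ ≠ 1`), Riemann in normal form (★, clause 4).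
[cite: MoeglinWaldspurger1995, IV.1.10–IV.1.11] [cite: Langlands1976, §6] [cite: ShahidiAJM1981, §2] -/
theorem hqa_of_eulerFactorisation
    (μ : Measure (quasiSplit (↥(maximalRealSubfield L)) L (IsCMField.complexConj L) 3).automorphicQuotient) [(quasiSplit (↥(maximalRealSubfield L)) L (IsCMField.complexConj L) 3).IsAutomorphicMeasure μ]
    (νG : Measure (quasiSplit (↥(maximalRealSubfield L)) L (IsCMField.complexConj L) 3).Adelic) [νG.IsHaarMeasure] [νG.IsInvInvariant] [SFinite νG]
    (ν : Measure ↥(adelicUnipotent (↥(maximalRealSubfield L)) L (IsCMField.complexConj L) 3)) [ν.IsHaarMeasure] [ν.IsMulRightInvariant] [ν.IsInvInvariant]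
    {𝓕 : Set ↥(adelicUnipotent (↥(maximalRealSubfield L)) L (IsCMField.complexConj L) 3)}
    (h𝓕N : IsFundamentalDomain ↥(rationalUnipotent (↥(maximalRealSubfield L)) L (IsCMField.complexConj L) 3) 𝓕 ν) (h𝓕c : IsCompact (closure 𝓕)) (h𝓕₀ : ν 𝓕 ≠ 0)
    {β : (quasiSplit (↥(maximalRealSubfield L)) L (IsCMField.complexConj L) 3).Adelic → ℝ≥0∞}
    (hβ : IsCoveringWeight ↥((arithmeticBorel (↥(maximalRealSubfield L)) L (IsCMField.complexConj L) 3).map (quasiSplit (↥(maximalRealSubfield L)) L (IsCMField.complexConj L) 3).arithmeticSubgroup.subtype) β)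
    {μZ : Measure (borelQuotient (↥(maximalRealSubfield L)) L (IsCMField.complexConj L) 3)} [SFinite μZ]
    (hμZ : ∀ f : borelQuotient (↥(maximalRealSubfield L)) L (IsCMField.complexConj L) 3 → ℝ≥0∞, Measurable f → ∫⁻ z, f z ∂μZ = ∫⁻ g, β g * f (toBorelQuotient (↥(maximalRealSubfield L)) L (IsCMField.complexConj L) 3 g) ∂νG)
    -- the M1 family: `φ ∈ V(χ, K, 1)` continuous bounded with `φ ∘ ι_∞ = φ(1)`, and a basis of `V(χʷ, K, 1)` by continuous bounded functions
    {χ : HeckeCharacter L} {K' : Subgroup (quasiSplit (↥(maximalRealSubfield L)) L (IsCMField.complexConj L) 3).Adelic} {ω : ↥K' → ℂ} {φ : (quasiSplit (↥(maximalRealSubfield L)) L (IsCMField.complexConj L) 3).Adelic → ℂ} (hφV : φ ∈ chiSectionSpace χ K' ω) (hφc : Continuous φ) {Mφ : ℝ} (hφM : ∀ x, ‖φ x‖ ≤ Mφ)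
    -- the LEVEL: `K′ ≤ K`, `ι(K_∞) ⊆ K′`, an open compact `U₀` with `ι_f(U₀ ∩ G_f) ⊆ K′` on which `ω = 1`, continuity of the sections; auxiliary Haar measures on `G_∞` (two-sided) and `G(𝔸_f)`
    (hK' : K' ≤ ((standardMaximalCompactGL 3 L).comap (adelicVal (↥(maximalRealSubfield L)) L (IsCMField.complexConj L) 3 ((StdForm.antidiagonal 3).over L)) : Subgroup (quasiSplit (↥(maximalRealSubfield L)) L (IsCMField.complexConj L) 3).Adelic))
    (hKinf : ∀ k : arch (↥(maximalRealSubfield L)) L (IsCMField.complexConj L) 3 ((StdForm.antidiagonal 3).over L), adelicVal (↥(maximalRealSubfield L)) L (IsCMField.complexConj L) 3 ((StdForm.antidiagonal 3).over L) (archToAdelic (↥(maximalRealSubfield L)) L (IsCMField.complexConj L) 3 _ k) ∈ standardMaximalCompactGL 3 L →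
      archToAdelic (↥(maximalRealSubfield L)) L (IsCMField.complexConj L) 3 _ k ∈ K')
    (U₀ : Subgroup (GL (Fin 3) (FiniteAdeleRing (𝓞 L) L))) (hU₀o : IsOpen (U₀ : Set (GL (Fin 3) (FiniteAdeleRing (𝓞 L) L)))) (hU₀c : IsCompact (U₀ : Set (GL (Fin 3) (FiniteAdeleRing (𝓞 L) L))))
    (hU : ∀ b : finAdelic (↥(maximalRealSubfield L)) L (IsCMField.complexConj L) 3 ((StdForm.antidiagonal 3).over L), (b : GL (Fin 3) (FiniteAdeleRing (𝓞 L) L)) ∈ U₀ →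
      ∃ hb : finAdelicToAdelic (↥(maximalRealSubfield L)) L (IsCMField.complexConj L) 3 ((StdForm.antidiagonal 3).over L) b ∈ K', ω ⟨_, hb⟩ = 1)
    (hVc : ∀ φ ∈ chiSectionSpace χ K' ω, Continuous φ)
    (μa : Measure (arch (↥(maximalRealSubfield L)) L (IsCMField.complexConj L) 3 ((StdForm.antidiagonal 3).over L))) [μa.IsHaarMeasure] [μa.IsMulRightInvariant]
    (μf : Measure (finAdelic (↥(maximalRealSubfield L)) L (IsCMField.complexConj L) 3 ((StdForm.antidiagonal 3).over L))) [μf.IsHaarMeasure]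
    {ι' : Type} [Fintype ι'] [DecidableEq ι'] (bV : Module.Basis ι' ℂ ↥(chiSectionSpace (reflectChar (IsCMField.complexConj L) χ) K' ω))
    (hbc : ∀ j, Continuous ((bV j : ↥(chiSectionSpace (reflectChar (IsCMField.complexConj L) χ) K' ω)) : (quasiSplit (↥(maximalRealSubfield L)) L (IsCMField.complexConj L) 3).Adelic → ℂ)) {Mb : ℝ} (hbM : ∀ j x, ‖((bV j : ↥(chiSectionSpace (reflectChar (IsCMField.complexConj L) χ) K' ω)) : (quasiSplit (↥(maximalRealSubfield L)) L (IsCMField.complexConj L) 3).Adelic → ℂ) x‖ ≤ Mb)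
    (h2 : Module.finrank (↥(maximalRealSubfield L)) L = 2) (hc : IsCMField.complexConj L ≠ 1) (hJ : ((StdForm.antidiagonal 3).over L).det ≠ 0)
    (ψ : ↥(TorusDict.torus (IsCMField.complexConj L)) →ₜ* ℂˣ) (hψ : TorusDict.IsAutomorphic (IsCMField.complexConj L) ψ)
    (h𝓕1 : ν 𝓕 = 1)
    -- ★ F4's frame for the partial `L`-ratio `cS`
    {φL : HeckeCharacter L} {η : HeckeCharacter ↥(maximalRealSubfield L)} {S : Set (HeightOneSpectrum (𝓞 L))} {T : Set (HeightOneSpectrum (𝓞 ↥(maximalRealSubfield L)))}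
    (hφL : φL.IsUnitary) (hφA : ∀ t : ℝ≥0ˣ, φL (posRealIdele L t) = 1) (hS : S.Finite) (hurφ : ∀ w ∉ S, φL.IsUnramifiedAt w)
    (hηu : η.IsUnitary) (hηA : ∀ t : ℝ≥0ˣ, η (posRealIdele ↥(maximalRealSubfield L) t) = 1) (hT : T.Finite) (hurη : ∀ v ∉ T, η.IsUnramifiedAt v) (hφ1 : φL ≠ 1)
    -- THE LETTER: the per-base-point Euler factorisation on `K_max`
    (hunfK : ∀ k : (quasiSplit (↥(maximalRealSubfield L)) L (IsCMField.complexConj L) 3).Adelic, adelicVal (↥(maximalRealSubfield L)) L (IsCMField.complexConj L) 3 ((StdForm.antidiagonal 3).over L) k ∈ standardMaximalCompactGL 3 L →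
      ∃ A : ℂ → ℂ, DifferentiableOn ℂ A {z : ℂ | 1 < z.re} ∧ ∀ z : ℂ, 2 < z.re →
        (∫ v : ↥(adelicUnipotent (↥(maximalRealSubfield L)) L (IsCMField.complexConj L) 3), flatSectionU φ z ((quasiSplit (↥(maximalRealSubfield L)) L (IsCMField.complexConj L) 3).toAdelic (weylLongU ((IsCMField.complexConj L : L ≃ₐ[↥(maximalRealSubfield L)] L) : L →+* L) (rfl : (StdForm.antidiagonal 3).over L = (StdForm.antidiagonal 3).over L)) * ((v : (quasiSplit (↥(maximalRealSubfield L)) L (IsCMField.complexConj L) 3).Adelic) * k)) ∂ν) = ((partialStandardL S (fun w => {φL.valueAtUniformizer w}) (z - 1) * partialStandardL T (fun v => {η.valueAtUniformizer v}) (2 * z - 2)) /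
            (partialStandardL S (fun w => {φL.valueAtUniformizer w}) z * partialStandardL T (fun v => {η.valueAtUniformizer v}) (2 * z - 1))) * A z) :
    ∀ j (z₀ : ℂ), z₀ ∈ midWitnessP L μ νG ν h𝓕N h𝓕c h𝓕₀ hβ hμZ hφV hφc hφM hK' hKinf U₀ hU₀o hU₀c hU hVc μa μf bV hbc hbM h2 hc hJ ψ hψ → 1 < z₀.re → z₀ ≠ (3 : ℂ) / 2 →
      AnalyticAt ℂ (midWitnessQc L μ νG ν h𝓕N h𝓕c h𝓕₀ hβ hμZ hφV hφc hφM hK' hKinf U₀ hU₀o hU₀c hU hVc μa μf bV hbc hbM h2 hc hJ ψ hψ j) z₀ := by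
  intro j z₀ hz₀P hz₀ h32
  obtain ⟨-, -, -, hNF, -, hqcq, hPc, hPcd, hPre, -, hqan, -⟩ := midWitnessExports_spec L μ νG ν h𝓕N h𝓕c h𝓕₀ hβ hμZ hφV hφc hφM hK' hKinf U₀ hU₀o hU₀c hU hVc μa μf bV hbc hbM h2 hc hJ ψ hψ
  obtain ⟨G, hGd, hGeq, hG2, -, -⟩ := exists_differentiableOn_mul_chiScalar_cm_three L hφL hφA hS hurφ hηu hηA hT hurη
  have hG20 : G 2 = 0 := not_not.1 fun h => hφ1 (hG2.1 h)
  obtain ⟨a, ha, hqa'⟩ := exists_eulerFactorisation_midWitness L μ νG ν h𝓕N h𝓕c h𝓕₀ hβ hμZ hφV hφc hφM hK' hKinf U₀ hU₀o hU₀c hU hVc μa μf bV hbc hbM h2 hc hJ ψ hψ h𝓕1 hunfK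
  -- the two sides, analytic on the connected `D := {1 < Re} ∖ P`, agree on the tube
  have hO : IsOpen {z : ℂ | 1 < z.re} := isOpen_lt continuous_const Complex.continuous_re
  have hDpc : IsPreconnected ({z : ℂ | 1 < z.re} \ midWitnessP L μ νG ν h𝓕N h𝓕c h𝓕₀ hβ hμZ hφV hφc hφM hK' hKinf U₀ hU₀o hU₀c hU hVc μa μf bV hbc hbM h2 hc hJ ψ hψ) :=
    isPreconnected_convex_diff_of_countable Literature.Topology.Euclidean.one_lt_rank_real_complex (convex_halfSpace_re_gt (1 : ℝ)) hO (countable_of_codiscrete hPcd)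
  have hu : AnalyticOnNhd ℂ (fun z => (z - 2) * (2 * z - 3) * midWitnessQc L μ νG ν h𝓕N h𝓕c h𝓕₀ hβ hμZ hφV hφc hφM hK' hKinf U₀ hU₀o hU₀c hU hVc μa μf bV hbc hbM h2 hc hJ ψ hψ j z) ({z : ℂ | 1 < z.re} \ midWitnessP L μ νG ν h𝓕N h𝓕c h𝓕₀ hβ hμZ hφV hφc hφM hK' hKinf U₀ hU₀o hU₀c hU hVc μa μf bV hbc hbM h2 hc hJ ψ hψ) :=
    fun z hz => ((analyticAt_id.sub analyticAt_const).mul ((analyticAt_const.mul analyticAt_id).sub analyticAt_const)).mul (hqan j z hz.2)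
  have hv : AnalyticOnNhd ℂ (fun z => G z * a j z) ({z : ℂ | 1 < z.re} \ midWitnessP L μ νG ν h𝓕N h𝓕c h𝓕₀ hβ hμZ hφV hφc hφM hK' hKinf U₀ hU₀o hU₀c hU hVc μa μf bV hbc hbM h2 hc hJ ψ hψ) :=
    fun z hz => (hGd.analyticAt (hO.mem_nhds hz.1)).mul ((ha j).analyticAt (hO.mem_nhds hz.1))
  have h3 : (3 : ℂ) ∈ {z : ℂ | 1 < z.re} \ midWitnessP L μ νG ν h𝓕N h𝓕c h𝓕₀ hβ hμZ hφV hφc hφM hK' hKinf U₀ hU₀o hU₀c hU hVc μa μf bV hbc hbM h2 hc hJ ψ hψ := by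
    refine ⟨by norm_num, fun h => ?_⟩
    have h' := hPre _ h
    norm_num at h'
  have heq : (fun z => (z - 2) * (2 * z - 3) * midWitnessQc L μ νG ν h𝓕N h𝓕c h𝓕₀ hβ hμZ hφV hφc hφM hK' hKinf U₀ hU₀o hU₀c hU hVc μa μf bV hbc hbM h2 hc hJ ψ hψ j z) =ᶠ[𝓝 (3 : ℂ)] fun z => G z * a j z := by
    filter_upwards [hO.mem_nhds (show (3 : ℂ) ∈ {z : ℂ | 1 < z.re} by norm_num), (isOpen_lt continuous_const Complex.continuous_re).mem_nhds (show (3 : ℂ) ∈ {z : ℂ | 2 < z.re} by norm_num)]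
      with z _ hz
    rw [hqcq j z hz, hqa' j z hz, ← hGeq z hz]
    ring
  have hEqOn := hu.eqOn_of_preconnected_of_eventuallyEq hv hDpc h3 heq
  -- the punctured neighbourhood of `z₀` lies in `D`; bound; Riemann in normal form
  have hDev : ∀ᶠ z in 𝓝[≠] z₀, z ∈ {z : ℂ | 1 < z.re} \ midWitnessP L μ νG ν h𝓕N h𝓕c h𝓕₀ hβ hμZ hφV hφc hφM hK' hKinf U₀ hU₀o hU₀c hU hVc μa μf bV hbc hbM h2 hc hJ ψ hψ := by
    filter_upwards [mem_nhdsWithin_of_mem_nhds (hO.mem_nhds hz₀), hPcd z₀] with z hz hzP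
    exact ⟨hz, hzP⟩
  have h2mem : (2 : ℂ) ∈ {z : ℂ | 1 < z.re} := by norm_num
  exact (hNF j (mem_univ z₀)).analyticAt_of_eventually_norm_le
    (eventually_norm_le_of_eqOn_mul hDev hEqOn ((hGd.differentiableAt (hO.mem_nhds hz₀)).mul ((ha j).differentiableAt (hO.mem_nhds hz₀))) h32
      fun h => by rw [hG20, zero_mul])

end Hqa

section Composed
variable (L : Type) [Field L] [NumberField L] [IsCMField L] [MeasurableSpace (quasiSplit (↥(maximalRealSubfield L)) L (IsCMField.complexConj L) 3).Adelic] [BorelSpace (quasiSplit (↥(maximalRealSubfield L)) L (IsCMField.complexConj L) 3).Adelic]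
  [MeasurableSpace (arch (↥(maximalRealSubfield L)) L (IsCMField.complexConj L) 3 ((StdForm.antidiagonal 3).over L))] [BorelSpace (arch (↥(maximalRealSubfield L)) L (IsCMField.complexConj L) 3 ((StdForm.antidiagonal 3).over L))]
  [MeasurableSpace (finAdelic (↥(maximalRealSubfield L)) L (IsCMField.complexConj L) 3 ((StdForm.antidiagonal 3).over L))] [BorelSpace (finAdelic (↥(maximalRealSubfield L)) L (IsCMField.complexConj L) 3 ((StdForm.antidiagonal 3).over L))]
  [MeasurableSpace (AdeleRing (𝓞 L) L)ˣ] [BorelSpace (AdeleRing (𝓞 L) L)ˣ]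

/-- **`hMSP′` AT THE NAMED WITNESS FAMILY FROM THE UNFOLDING LETTER** — ★ p864687 `hMSP'_midWitness_of_coordLetters` with its `hqa` PAID by `hqa_of_eulerFactorisation`: visible are the
Maass–Selberg frame extras, ★ F4's frame (`φ ≠ 1`), the per-base-point factorisation `hunfK` on `K_max`, and the axis-reality letter `hreal` (self-associate case). Conclusion = the
`hMSP′` binder of ★ `ledgerLetters_of_exports` ∕ (V) OF RECORD, byte for byte. [cite: MoeglinWaldspurger1995, IV.1.10–IV.1.11, IV.3.12 (a)] [cite: Langlands1976, §6] -/
theorem hMSP'_midWitness_of_unfolding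
    (μ : Measure (quasiSplit (↥(maximalRealSubfield L)) L (IsCMField.complexConj L) 3).automorphicQuotient) [(quasiSplit (↥(maximalRealSubfield L)) L (IsCMField.complexConj L) 3).IsAutomorphicMeasure μ]
    (νG : Measure (quasiSplit (↥(maximalRealSubfield L)) L (IsCMField.complexConj L) 3).Adelic) [νG.IsHaarMeasure] [νG.IsInvInvariant] [SFinite νG]
    (ν : Measure ↥(adelicUnipotent (↥(maximalRealSubfield L)) L (IsCMField.complexConj L) 3)) [ν.IsHaarMeasure] [ν.IsMulRightInvariant] [ν.IsInvInvariant]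
    {𝓕 : Set ↥(adelicUnipotent (↥(maximalRealSubfield L)) L (IsCMField.complexConj L) 3)}
    (h𝓕N : IsFundamentalDomain ↥(rationalUnipotent (↥(maximalRealSubfield L)) L (IsCMField.complexConj L) 3) 𝓕 ν) (h𝓕c : IsCompact (closure 𝓕)) (h𝓕₀ : ν 𝓕 ≠ 0)
    {β : (quasiSplit (↥(maximalRealSubfield L)) L (IsCMField.complexConj L) 3).Adelic → ℝ≥0∞}
    (hβ : IsCoveringWeight ↥((arithmeticBorel (↥(maximalRealSubfield L)) L (IsCMField.complexConj L) 3).map (quasiSplit (↥(maximalRealSubfield L)) L (IsCMField.complexConj L) 3).arithmeticSubgroup.subtype) β)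
    {μZ : Measure (borelQuotient (↥(maximalRealSubfield L)) L (IsCMField.complexConj L) 3)} [SFinite μZ]
    (hμZ : ∀ f : borelQuotient (↥(maximalRealSubfield L)) L (IsCMField.complexConj L) 3 → ℝ≥0∞, Measurable f → ∫⁻ z, f z ∂μZ = ∫⁻ g, β g * f (toBorelQuotient (↥(maximalRealSubfield L)) L (IsCMField.complexConj L) 3 g) ∂νG)
    -- the M1 family: `φ ∈ V(χ, K, 1)` continuous bounded with `φ ∘ ι_∞ = φ(1)`, and a basis of `V(χʷ, K, 1)` by continuous bounded functions
    {χ : HeckeCharacter L} {K' : Subgroup (quasiSplit (↥(maximalRealSubfield L)) L (IsCMField.complexConj L) 3).Adelic} {ω : ↥K' → ℂ} {φ : (quasiSplit (↥(maximalRealSubfield L)) L (IsCMField.complexConj L) 3).Adelic → ℂ} (hφV : φ ∈ chiSectionSpace χ K' ω) (hφc : Continuous φ) {Mφ : ℝ} (hφM : ∀ x, ‖φ x‖ ≤ Mφ)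
    -- the LEVEL: `K′ ≤ K`, `ι(K_∞) ⊆ K′`, an open compact `U₀` with `ι_f(U₀ ∩ G_f) ⊆ K′` on which `ω = 1`, continuity of the sections; auxiliary Haar measures on `G_∞` (two-sided) and `G(𝔸_f)`
    (hK' : K' ≤ ((standardMaximalCompactGL 3 L).comap (adelicVal (↥(maximalRealSubfield L)) L (IsCMField.complexConj L) 3 ((StdForm.antidiagonal 3).over L)) : Subgroup (quasiSplit (↥(maximalRealSubfield L)) L (IsCMField.complexConj L) 3).Adelic))
    (hKinf : ∀ k : arch (↥(maximalRealSubfield L)) L (IsCMField.complexConj L) 3 ((StdForm.antidiagonal 3).over L), adelicVal (↥(maximalRealSubfield L)) L (IsCMField.complexConj L) 3 ((StdForm.antidiagonal 3).over L) (archToAdelic (↥(maximalRealSubfield L)) L (IsCMField.complexConj L) 3 _ k) ∈ standardMaximalCompactGL 3 L →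
      archToAdelic (↥(maximalRealSubfield L)) L (IsCMField.complexConj L) 3 _ k ∈ K')
    (U₀ : Subgroup (GL (Fin 3) (FiniteAdeleRing (𝓞 L) L))) (hU₀o : IsOpen (U₀ : Set (GL (Fin 3) (FiniteAdeleRing (𝓞 L) L)))) (hU₀c : IsCompact (U₀ : Set (GL (Fin 3) (FiniteAdeleRing (𝓞 L) L))))
    (hU : ∀ b : finAdelic (↥(maximalRealSubfield L)) L (IsCMField.complexConj L) 3 ((StdForm.antidiagonal 3).over L), (b : GL (Fin 3) (FiniteAdeleRing (𝓞 L) L)) ∈ U₀ →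
      ∃ hb : finAdelicToAdelic (↥(maximalRealSubfield L)) L (IsCMField.complexConj L) 3 ((StdForm.antidiagonal 3).over L) b ∈ K', ω ⟨_, hb⟩ = 1)
    (hVc : ∀ φ ∈ chiSectionSpace χ K' ω, Continuous φ)
    (μa : Measure (arch (↥(maximalRealSubfield L)) L (IsCMField.complexConj L) 3 ((StdForm.antidiagonal 3).over L))) [μa.IsHaarMeasure] [μa.IsMulRightInvariant]
    (μf : Measure (finAdelic (↥(maximalRealSubfield L)) L (IsCMField.complexConj L) 3 ((StdForm.antidiagonal 3).over L))) [μf.IsHaarMeasure]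
    {ι' : Type} [Fintype ι'] [DecidableEq ι'] (bV : Module.Basis ι' ℂ ↥(chiSectionSpace (reflectChar (IsCMField.complexConj L) χ) K' ω))
    (hbc : ∀ j, Continuous ((bV j : ↥(chiSectionSpace (reflectChar (IsCMField.complexConj L) χ) K' ω)) : (quasiSplit (↥(maximalRealSubfield L)) L (IsCMField.complexConj L) 3).Adelic → ℂ)) {Mb : ℝ} (hbM : ∀ j x, ‖((bV j : ↥(chiSectionSpace (reflectChar (IsCMField.complexConj L) χ) K' ω)) : (quasiSplit (↥(maximalRealSubfield L)) L (IsCMField.complexConj L) 3).Adelic → ℂ) x‖ ≤ Mb)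
    (h2 : Module.finrank (↥(maximalRealSubfield L)) L = 2) (hc : IsCMField.complexConj L ≠ 1) (hJ : ((StdForm.antidiagonal 3).over L).det ≠ 0)
    (ψ : ↥(TorusDict.torus (IsCMField.complexConj L)) →ₜ* ℂˣ) (hψ : TorusDict.IsAutomorphic (IsCMField.complexConj L) ψ)
    -- the Maass–Selberg frame extras
    (μK : Measure ((standardMaximalCompactGL 3 L).comap (adelicVal (↥(maximalRealSubfield L)) L (IsCMField.complexConj L) 3 ((StdForm.antidiagonal 3).over L)) : Subgroup (quasiSplit (↥(maximalRealSubfield L)) L (IsCMField.complexConj L) 3).Adelic))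
    [μK.IsHaarMeasure]
    (νI : Measure (AdeleRing (𝓞 L) L)ˣ) [νI.IsHaarMeasure]
    {𝓕I : Set (AdeleRing (𝓞 L) L)ˣ} (h𝓕I : IsIdeleClassDomain L 𝓕I) (h𝓕1 : ν 𝓕 = 1)
    (hχ₁ : χ.IsUnitary) (hρ₁ : ∀ r : ℝ≥0ˣ, χ (posRealIdele L r) = 1)
    -- ★ F4's frame for the partial `L`-ratio `cS`
    {φL : HeckeCharacter L} {η : HeckeCharacter ↥(maximalRealSubfield L)} {S : Set (HeightOneSpectrum (𝓞 L))} {T : Set (HeightOneSpectrum (𝓞 ↥(maximalRealSubfield L)))}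
    (hφL : φL.IsUnitary) (hφA : ∀ t : ℝ≥0ˣ, φL (posRealIdele L t) = 1) (hS : S.Finite) (hurφ : ∀ w ∉ S, φL.IsUnramifiedAt w)
    (hηu : η.IsUnitary) (hηA : ∀ t : ℝ≥0ˣ, η (posRealIdele ↥(maximalRealSubfield L) t) = 1) (hT : T.Finite) (hurη : ∀ v ∉ T, η.IsUnramifiedAt v) (hφ1 : φL ≠ 1)
    -- THE LETTER: the per-base-point Euler factorisation on `K_max`
    (hunfK : ∀ k : (quasiSplit (↥(maximalRealSubfield L)) L (IsCMField.complexConj L) 3).Adelic, adelicVal (↥(maximalRealSubfield L)) L (IsCMField.complexConj L) 3 ((StdForm.antidiagonal 3).over L) k ∈ standardMaximalCompactGL 3 L →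
      ∃ A : ℂ → ℂ, DifferentiableOn ℂ A {z : ℂ | 1 < z.re} ∧ ∀ z : ℂ, 2 < z.re →
        (∫ v : ↥(adelicUnipotent (↥(maximalRealSubfield L)) L (IsCMField.complexConj L) 3), flatSectionU φ z ((quasiSplit (↥(maximalRealSubfield L)) L (IsCMField.complexConj L) 3).toAdelic (weylLongU ((IsCMField.complexConj L : L ≃ₐ[↥(maximalRealSubfield L)] L) : L →+* L) (rfl : (StdForm.antidiagonal 3).over L = (StdForm.antidiagonal 3).over L)) * ((v : (quasiSplit (↥(maximalRealSubfield L)) L (IsCMField.complexConj L) 3).Adelic) * k)) ∂ν) = ((partialStandardL S (fun w => {φL.valueAtUniformizer w}) (z - 1) * partialStandardL T (fun v => {η.valueAtUniformizer v}) (2 * z - 2)) /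
            (partialStandardL S (fun w => {φL.valueAtUniformizer w}) z * partialStandardL T (fun v => {η.valueAtUniformizer v}) (2 * z - 1))) * A z)
    -- the axis-reality letter (self-associate case)
    (hreal : ∀ x : ℝ, 1 < x → ((x : ℝ) : ℂ) ∉ midWitnessP L μ νG ν h𝓕N h𝓕c h𝓕₀ hβ hμZ hφV hφc hφM hK' hKinf U₀ hU₀o hU₀c hU hVc μa μf bV hbc hbM h2 hc hJ ψ hψ →
      (((∑ j, midWitnessQc L μ νG ν h𝓕N h𝓕c h𝓕₀ hβ hμZ hφV hφc hφM hK' hKinf U₀ hU₀o hU₀c hU hVc μa μf bV hbc hbM h2 hc hJ ψ hψ j (x : ℂ) * ∫ k, ((bV j : ↥(chiSectionSpace (reflectChar (IsCMField.complexConj L) χ) K' ω)) : (quasiSplit (↥(maximalRealSubfield L)) L (IsCMField.complexConj L) 3).Adelic → ℂ) (k : (quasiSplit (↥(maximalRealSubfield L)) L (IsCMField.complexConj L) 3).Adelic) * conj (φ (k : (quasiSplit (↥(maximalRealSubfield L)) L (IsCMField.complexConj L) 3).Adelic)) ∂μK) *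
        ∫ x in {x : (AdeleRing (𝓞 L) L)ˣ | (IdeleClassGroup.ideleNorm L x : ℝ) ≤ 1} ∩ 𝓕I, ((IdeleClassGroup.ideleNorm L x : ℝ) : ℂ) * (((reflectChar (IsCMField.complexConj L) χ x : ℂˣ) : ℂ) * conj ((χ x : ℂˣ) : ℂ)) ∂νI)).im = 0) :
    ∀ z₀ ∈ midWitnessP L μ νG ν h𝓕N h𝓕c h𝓕₀ hβ hμZ hφV hφc hφM hK' hKinf U₀ hU₀o hU₀c hU hVc μa μf bV hbc hbM h2 hc hJ ψ hψ, 1 < z₀.re → z₀ ≠ (3 : ℂ) / 2 → ∀ T : ℝ≥0, 1 ≤ T →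
      ∃ Fam : ℂ → (quasiSplit (↥(maximalRealSubfield L)) L (IsCMField.complexConj L) 3).L2 μ,
        (∀ z : ℂ, z ∉ midWitnessP L μ νG ν h𝓕N h𝓕c h𝓕₀ hβ hμZ hφV hφc hφM hK' hKinf U₀ hU₀o hU₀c hU hVc μa μf bV hbc hbM h2 hc hJ ψ hψ → ((Fam z : (quasiSplit (↥(maximalRealSubfield L)) L (IsCMField.complexConj L) 3).L2 μ) : (quasiSplit (↥(maximalRealSubfield L)) L (IsCMField.complexConj L) 3).automorphicQuotient → ℂ) =ᵐ[μ] (quasiSplit (↥(maximalRealSubfield L)) L (IsCMField.complexConj L) 3).quotFun (truncation ν 𝓕 T (midWitnessEc L μ νG ν h𝓕N h𝓕c h𝓕₀ hβ hμZ hφV hφc hφM hK' hKinf U₀ hU₀o hU₀c hU hVc μa μf bV hbc hbM h2 hc hJ ψ hψ z))) ∧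
        ∃ C : ℝ, ∀ᶠ z in 𝓝[≠] z₀, ‖Fam z‖ ≤ C :=
  hMSP'_midWitness_of_coordLetters L μ νG ν h𝓕N h𝓕c h𝓕₀ hβ hμZ hφV hφc hφM hK' hKinf U₀ hU₀o hU₀c hU hVc μa μf bV hbc hbM h2 hc hJ ψ hψ μK νI h𝓕I h𝓕1 hχ₁ hρ₁
    (hqa_of_eulerFactorisation L μ νG ν h𝓕N h𝓕c h𝓕₀ hβ hμZ hφV hφc hφM hK' hKinf U₀ hU₀o hU₀c hU hVc μa μf bV hbc hbM h2 hc hJ ψ hψ h𝓕1 hφL hφA hS hurφ hηu hηA hT hurη hφ1 hunfK) hreal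

end Composed

end Summit.HodgeConjecture.HodgeConjecture.Cruxes.H413.K2E1ChiScatteringCoordsEulerFactorisationCMThree

end
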